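import Mathlib
import HarnessLib
import Summits.AtomisticToContinuum.FouriersLaw.Theorems.VanishingNoiseTransferNoisyFourierFlipCeilingField

/-!
# The fixed-`L` Abel limit of the open-chain Green–Kubo functional, I: corrector, energy estimate, odd pairing

`--supports stmt-AtomisticToContinuum-11977` helper file (crux `NoisyFourier`, route `VanishingNoiseTransfer`,
line `abel-kapitza-even-corrector`, registered helper `helper_abelLimitEnergyEstimate` of stub `stub_abelLimit`;
Aux file 1 of the stub, whose assembly `…NoisyFourierAbelLimit.lean` imports it).

Setting: `𝐏 = pinnedChain ω₂ lam β γ` (all parameters `> 0`), `μ_T = 𝐏.gibbsMeasure L T`, the flip-noisy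
equilibrium generator `L_ε = X_H + γ S_B + ε S` (`flipGenerator`), `k_0 = p_0² − T`, the total current
`J = Σ_i j_i`, the block energies `E_{≤i} = leftEnergy 𝐏 L i`, the flips `F_i = momentumFlip i`.

* `flipGenerator_add'/_const_mul'/_sub'/_sum'` — linearity of `L_ε` on `C²` (from `generator_add`,
  `generator_const_mul` and the linearity of `S`).
* `flipGenerator_leftEnergy` — `L_ε E_{≤i} = −j_i − γ k_0` for a genuine bond (`liouvilleOp_leftEnergy`,
  `leftEnergy_backwardPair`, `S E_{≤i} = 0`); `flipGenerator_corrector` — on `m + 1` sites the explicit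
  `u₀ = Σ_{i<m} (E_{≤i} − γ g)` solves `L_ε u₀ = −J` for every classical forward field `g` (`L_ε g = −k_0`).
* `flipDirichlet_le` — ENERGY ESTIMATE: `L_ε d = s d + s w`, `s ≥ 0`, `d ∈ C² ∩ L²`, `w ∈ L²` imply
  `ε Σ_i ‖d∘F_i − d‖² ≤ s ‖w‖²` (`Kubo.fluctuation_dissipation` for the plain forward pair
  `(d, −s d − s w + ε S d)`, the flip Dirichlet form `integral_mul_flipNoise_self`, and `−s d² − s d w ≤ (s/4) w²`).
* `abs_integral_sum_bondCurrent_mul_le` — ODD PAIRING: `|∫ J v| ≤ L √(M Σ_i ‖v∘F_i − v‖²)` for all `L` and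
  `v ∈ L²(μ_T)` (each half current is odd under one flip: `sq_integral_mul_le_of_odd`, `gibbsHalfCurrentSqLe`).
* `helper_abelLimitEnergyEstimate` — the registered helper (notation-free restatement of `flipDirichlet_le`;
  the constant is uniform in `L` and in the flip rate `ε`).

References: Bernardin–Olla 2011 §3; Bonetto–Lebowitz–Rey-Bellet 2000 §5.2; folklore.
-/

noncomputable section

open MeasureTheory Filter Topology
open scoped BigOperators ContDiff
open Literature.MathematicalPhysics.KineticTheory.HeatConduction
open Literature.MathematicalPhysics.KineticTheory.HeatConduction.HardTether (leftEnergy)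
open Summit.AtomisticToContinuum.FouriersLaw.Theorems.SuperadditiveResistance.DeviceLiouville
  (kin kin_eq_sq liouvilleOp bathOp)
open Summit.AtomisticToContinuum.FouriersLaw.Theorems.SuperadditiveResistance.Kubo
  (fluctuation_dissipation partition_pos)
open Summit.AtomisticToContinuum.FouriersLaw.Theorems.OddSectorIrreversibility
  (generator_add generator_const_mul)
open Summit.AtomisticToContinuum.FouriersLaw.Cruxes.SuperadditiveResistance.InsertionToolbox
  (pinnedChain_memLp_two_of_abs_le)
open Summit.AtomisticToContinuum.FouriersLaw.Theorems.VanishingNoiseBound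
  (memLp_flipNoise flip_forwardPair gibbs_flipInvariant contDiff_leftEnergy' leftEnergy_momentumFlip
    flipNoise_eq_zero_of_invariant integral_mul_flipNoise_self flipGenerator_eq_pair)
open Summit.AtomisticToContinuum.FouriersLaw.Theorems.NoisyFourier.FlipCeiling
  (liouvilleOp_leftEnergy leftEnergy_backwardPair sq_integral_mul_le_of_odd gibbsHalfCurrentSqLe)

namespace Summit.AtomisticToContinuum.FouriersLaw.Cruxes.NoisyFourier.AbelKapitzaEvenCorrector

/-! ## Linearity of the flip-noisy generator on `C²` -/

section Linearity

variable {L : ℕ}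

/-- `S` is additive. [folklore] -/
theorem flipNoise_add' (f g : PhaseSpace L → ℝ) (x : PhaseSpace L) :
    flipNoise L (fun y => f y + g y) x = flipNoise L f x + flipNoise L g x := by
  simp only [flipNoise_eq, ← Finset.sum_add_distrib]
  exact Finset.sum_congr rfl fun i _ => by ring

/-- `S` is homogeneous. [folklore] -/
theorem flipNoise_const_mul' (c : ℝ) (f : PhaseSpace L → ℝ) (x : PhaseSpace L) :
    flipNoise L (fun y => c * f y) x = c * flipNoise L f x := by
  simp only [flipNoise_eq, Finset.mul_sum]
  exact Finset.sum_congr rfl fun i _ => by ring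

/-- `L_ε` is additive on `C²`. [folklore] -/
theorem flipGenerator_add' (P : OscillatorChain) (T_L T_R ε : ℝ) {f g : PhaseSpace L → ℝ}
    (hf : ContDiff ℝ 2 f) (hg : ContDiff ℝ 2 g) (x : PhaseSpace L) :
    P.flipGenerator L T_L T_R ε (fun y => f y + g y) x =
      P.flipGenerator L T_L T_R ε f x + P.flipGenerator L T_L T_R ε g x := by
  rw [OscillatorChain.flipGenerator_eq_add_flipNoise, OscillatorChain.flipGenerator_eq_add_flipNoise,
    OscillatorChain.flipGenerator_eq_add_flipNoise, generator_add P L T_L T_R hf hg, flipNoise_add']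
  ring

/-- `L_ε` is homogeneous. [folklore] -/
theorem flipGenerator_const_mul' (P : OscillatorChain) (T_L T_R ε c : ℝ) (f : PhaseSpace L → ℝ)
    (x : PhaseSpace L) :
    P.flipGenerator L T_L T_R ε (fun y => c * f y) x = c * P.flipGenerator L T_L T_R ε f x := by
  rw [OscillatorChain.flipGenerator_eq_add_flipNoise, OscillatorChain.flipGenerator_eq_add_flipNoise,
    generator_const_mul, flipNoise_const_mul']
  ring

/-- `L_ε` is subtractive on `C²`. [folklore] -/
theorem flipGenerator_sub' (P : OscillatorChain) (T_L T_R ε : ℝ) {f g : PhaseSpace L → ℝ}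
    (hf : ContDiff ℝ 2 f) (hg : ContDiff ℝ 2 g) (x : PhaseSpace L) :
    P.flipGenerator L T_L T_R ε (fun y => f y - g y) x =
      P.flipGenerator L T_L T_R ε f x - P.flipGenerator L T_L T_R ε g x := by
  have e : (fun y => f y - g y) = fun y => f y + (-1) * g y := funext fun y => by ring
  rw [e, flipGenerator_add' P T_L T_R ε hf (contDiff_const.mul hg), flipGenerator_const_mul']
  ring

/-- `L_ε` commutes with finite sums of `C²` functions. [folklore] -/
theorem flipGenerator_sum' (P : OscillatorChain) (T_L T_R ε : ℝ) {ι : Type*} (s : Finset ι)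
    {F : ι → PhaseSpace L → ℝ} (hF : ∀ i ∈ s, ContDiff ℝ 2 (F i)) (x : PhaseSpace L) :
    P.flipGenerator L T_L T_R ε (fun y => ∑ i ∈ s, F i y) x = ∑ i ∈ s, P.flipGenerator L T_L T_R ε (F i) x := by
  classical
  induction s using Finset.induction_on with
  | empty => simp only [Finset.sum_empty, OscillatorChain.flipGenerator_const]
  | insert a s ha ih =>
    have hs : ∀ i ∈ s, ContDiff ℝ 2 (F i) := fun i hi => hF i (Finset.mem_insert_of_mem hi)
    have hsum : ContDiff ℝ 2 (fun y => ∑ i ∈ s, F i y) := ContDiff.sum fun i hi => hs i hi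
    rw [Finset.sum_insert ha, ← ih hs, ← flipGenerator_add' P T_L T_R ε (hF a (Finset.mem_insert_self a s)) hsum]
    simp only [Finset.sum_insert ha]

/-- The last site carries no bond: `j_{m} = 0` on `m + 1` sites. [folklore] -/
theorem bondCurrent_fin_last (P : OscillatorChain) (m : ℕ) (x : PhaseSpace (m + 1)) :
    P.bondCurrent (m + 1) (Fin.last m) x = 0 := by
  unfold OscillatorChain.bondCurrent
  refine Finset.sum_eq_zero fun j _ => ?_
  rw [if_neg]
  intro h
  have := j.isLt
  rw [Fin.val_last] at h
  omega

end Linearity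

/-! ## The explicit `s = 0` corrector -/

section Corrector

variable {ω₂ lam β γ : ℝ} {L : ℕ}

/-- `L_ε E_{≤i} = −j_i − γ(p_0² − T)` for a genuine bond `i` (`i + 1 < L`): the discrete continuity equation
`X_H E_{≤i} = −j_i`, only the left bath touches the block (`S_B E_{≤i} = T − p_0²`), and `S E_{≤i} = 0`.
[Bonetto–Lebowitz–Rey-Bellet 2000, §5.2] [folklore] -/
theorem flipGenerator_leftEnergy (T ε : ℝ) {i : Fin L} (hi : i.val + 1 < L) (x : PhaseSpace L) :
    (pinnedChain ω₂ lam β γ).flipGenerator L T T ε (leftEnergy (pinnedChain ω₂ lam β γ) L i) x =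
      -(pinnedChain ω₂ lam β γ).bondCurrent L i x - γ * (kin L 0 x - T) := by
  have hU : Differentiable ℝ (pinnedChain ω₂ lam β γ).U :=
    (pinnedChain_contDiff_U ω₂ lam β γ (n := 1)).differentiable one_ne_zero
  have hV : Differentiable ℝ (pinnedChain ω₂ lam β γ).V :=
    (pinnedChain_contDiff_V ω₂ lam β γ (n := 1)).differentiable one_ne_zero
  have h1 := liouvilleOp_leftEnergy (pinnedChain ω₂ lam β γ) hU hV i x
  have h2 := leftEnergy_backwardPair (ω₂ := ω₂) (lam := lam) (β := β) (γ := γ) T hi x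
  have h3 : flipNoise L (leftEnergy (pinnedChain ω₂ lam β γ) L i) x = 0 :=
    flipNoise_eq_zero_of_invariant (fun k y => leftEnergy_momentumFlip (pinnedChain ω₂ lam β γ) i k y) x
  rw [flipGenerator_eq_pair, h3]
  linear_combination h2 + 2 * h1

/-- **The `s = 0` corrector.** On `m + 1` sites, `u₀ = Σ_{i<m} (E_{≤i} − γ g)` solves `L_ε u₀ = −J` pointwise
for every classical forward field `g` (`L_ε g = −(p_0² − T)`). [folklore] -/
theorem flipGenerator_corrector (T ε : ℝ) {m : ℕ} {g : PhaseSpace (m + 1) → ℝ} (hg2 : ContDiff ℝ 2 g)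
    (hpde : ∀ x, (pinnedChain ω₂ lam β γ).flipGenerator (m + 1) T T ε g x = -(kin (m + 1) 0 x - T))
    (x : PhaseSpace (m + 1)) :
    (pinnedChain ω₂ lam β γ).flipGenerator (m + 1) T T ε
        (fun y => ∑ i : Fin m, (leftEnergy (pinnedChain ω₂ lam β γ) (m + 1) (Fin.castSucc i) y - γ * g y)) x =
      -∑ i : Fin (m + 1), (pinnedChain ω₂ lam β γ).bondCurrent (m + 1) i x := by
  set P := pinnedChain ω₂ lam β γ with hP
  have hE2 : ∀ i : Fin (m + 1), ContDiff ℝ 2 (leftEnergy P (m + 1) i) := fun i =>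
    contDiff_leftEnergy' P (pinnedChain_contDiff_U ω₂ lam β γ) (pinnedChain_contDiff_V ω₂ lam β γ) (m + 1) i
  have hγg : ContDiff ℝ 2 (fun y => γ * g y) := contDiff_const.mul hg2
  have hF : ∀ i ∈ (Finset.univ : Finset (Fin m)),
      ContDiff ℝ 2 (fun y => leftEnergy P (m + 1) (Fin.castSucc i) y - γ * g y) := fun i _ =>
    (hE2 _).sub hγg
  rw [flipGenerator_sum' P T T ε Finset.univ hF x, Fin.sum_univ_castSucc (fun i => P.bondCurrent (m + 1) i x),
    bondCurrent_fin_last, add_zero, ← Finset.sum_neg_distrib]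
  refine Finset.sum_congr rfl fun i _ => ?_
  have hi : (Fin.castSucc i).val + 1 < m + 1 := by
    rw [Fin.val_castSucc]; have := i.isLt; omega
  rw [flipGenerator_sub' P T T ε (hE2 _) hγg, flipGenerator_const_mul', hpde x,
    flipGenerator_leftEnergy T ε hi x]
  ring

end Corrector

/-! ## The energy estimate and the odd-pairing bound -/

section Estimates

variable {ω₂ lam β γ : ℝ}

/-- The bond currents of the pinned chain are in `L²(μ_T)`. [folklore] -/
theorem memLp_bondCurrent (hω : 0 < ω₂) (hl : 0 ≤ lam) (hβ : 0 ≤ β) (γ : ℝ) (L : ℕ) {T : ℝ} (hT : 0 < T)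
    (i : Fin L) :
    MemLp ((pinnedChain ω₂ lam β γ).bondCurrent L i) 2 ((pinnedChain ω₂ lam β γ).gibbsMeasure L T) :=
  pinnedChain_memLp_two_of_abs_le hω hl hβ γ L hT (pinnedChain_continuous_bondCurrent ω₂ lam β γ L i)
    (C := (L : ℝ) * ((3 + β) / 2)) (k := 2) fun x => by
    calc |(pinnedChain ω₂ lam β γ).bondCurrent L i x|
          ≤ L * ((3 + β) / 2 * (1 + (pinnedChain ω₂ lam β γ).hamiltonian L x) ^ 2) :=
          pinnedChain_abs_bondCurrent_le hω.le hl hβ γ L i x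
      _ = (L : ℝ) * ((3 + β) / 2) * (1 + (pinnedChain ω₂ lam β γ).hamiltonian L x) ^ 2 := by ring

/-- `∫ J v = Σ_i ∫ j_i v` for `v ∈ L²(μ_T)`. [folklore] -/
theorem integral_sum_bondCurrent_mul (hω : 0 < ω₂) (hl : 0 ≤ lam) (hβ : 0 ≤ β) (γ : ℝ) (L : ℕ) {T : ℝ}
    (hT : 0 < T) {v : PhaseSpace L → ℝ} (hv : MemLp v 2 ((pinnedChain ω₂ lam β γ).gibbsMeasure L T)) :
    ∫ x, (∑ i : Fin L, (pinnedChain ω₂ lam β γ).bondCurrent L i x) * v x ∂((pinnedChain ω₂ lam β γ).gibbsMeasure L T) =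
      ∑ i : Fin L, ∫ x, (pinnedChain ω₂ lam β γ).bondCurrent L i x * v x ∂((pinnedChain ω₂ lam β γ).gibbsMeasure L T) := by
  have e : (fun x => (∑ i : Fin L, (pinnedChain ω₂ lam β γ).bondCurrent L i x) * v x) =
      fun x => ∑ i : Fin L, (pinnedChain ω₂ lam β γ).bondCurrent L i x * v x := by
    funext x; rw [Finset.sum_mul]
  have hI : ∀ i : Fin L, Integrable (fun x => (pinnedChain ω₂ lam β γ).bondCurrent L i x * v x)
      ((pinnedChain ω₂ lam β γ).gibbsMeasure L T) := fun i =>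
    (memLp_bondCurrent hω hl hβ γ L hT i).integrable_mul hv
  rw [e, integral_finsetSum _ fun i _ => hI i]

/-- **Energy estimate.** If `d, w ∈ L²(μ_T)`, `d ∈ C²`, `s ≥ 0`, `ε : ℝ` and `L_ε d = s d + s w` pointwise, then
`ε Σ_i ‖d∘F_i − d‖²_{L²(μ_T)} ≤ s ‖w‖²_{L²(μ_T)}`: `(d, −s d − s w + ε S d)` is a plain forward pair, so
fluctuation–dissipation gives `0 ≤ ∫ d(−s d − s w) dμ_T − (ε/2) Σ_i ‖d∘F_i − d‖²`, and `−s d² − s d w ≤ (s/4) w²`.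
[cite: BernardinOlla2011, §3] [folklore] -/
theorem flipDirichlet_le (hω : 0 < ω₂) (hl : 0 < lam) (hβ : 0 < β) (hγ : 0 < γ) {T : ℝ} (hT : 0 < T)
    (ε : ℝ) (L : ℕ) {s : ℝ} (hs : 0 ≤ s) {d w : PhaseSpace L → ℝ}
    (hd2 : ContDiff ℝ 2 d) (hdL : MemLp d 2 ((pinnedChain ω₂ lam β γ).gibbsMeasure L T))
    (hwL : MemLp w 2 ((pinnedChain ω₂ lam β γ).gibbsMeasure L T))
    (hpde : ∀ x, (pinnedChain ω₂ lam β γ).flipGenerator L T T ε d x = s * d x + s * w x) :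
    ε * ∑ i : Fin L, ∫ x, (d (momentumFlip i x) - d x) ^ 2 ∂((pinnedChain ω₂ lam β γ).gibbsMeasure L T) ≤
      s * ∫ x, w x ^ 2 ∂((pinnedChain ω₂ lam β γ).gibbsMeasure L T) := by
  set P := pinnedChain ω₂ lam β γ with hP
  set μ := P.gibbsMeasure L T with hμ
  have hflip := gibbs_flipInvariant (ω₂ := ω₂) (lam := lam) (β := β) (γ := γ) L T
  set B := OscillatorChain.bathWeight L with hB
  have hB0 : ∀ i, 0 ≤ B i := by
    intro i
    simp only [hB, OscillatorChain.bathWeight]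
    positivity
  -- the plain forward pair `(d, k')`
  set k₁ : PhaseSpace L → ℝ := fun x => -(s * d x + s * w x) with hk₁
  have hpde' : ∀ x, P.flipGenerator L T T ε d x = -k₁ x := fun x => by rw [hpde x, hk₁]; ring
  set k' : PhaseSpace L → ℝ := fun x => k₁ x + ε * flipNoise L d x with hk'
  have hpair : ∀ x, 1 * liouvilleOp P L d x + γ * bathOp L B T d x = -k' x := fun x =>
    flip_forwardPair (ω₂ := ω₂) (lam := lam) (β := β) (γ := γ) L T ε (k := k₁) hpde' x
  have hSdL2 : MemLp (flipNoise L d) 2 μ := memLp_flipNoise hflip hdL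
  have hk₁L2 : MemLp k₁ 2 μ := ((hdL.const_mul s).add (hwL.const_mul s)).neg
  have hk'L2 : MemLp k' 2 μ := hk₁L2.add (hSdL2.const_mul ε)
  -- fluctuation–dissipation: `0 ≤ ∫ d k' dμ`
  have hFD := fluctuation_dissipation hω hl.le hβ.le L hT B hB0 1 hγ hd2 hdL hk'L2 hpair
  have hpos : 0 ≤ ∫ x, d x * k' x ∂μ := by
    rw [P.integral_gibbsMeasure, hFD]
    refine mul_nonneg (inv_nonneg.2 (partition_pos hω hl.le hβ.le L hT).le) ?_
    refine mul_nonneg (by positivity) (Finset.sum_nonneg fun i _ => mul_nonneg (hB0 i) ?_)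
    exact integral_nonneg fun x => mul_nonneg (sq_nonneg _) (P.gibbsDensity_pos L T x).le
  -- split `∫ d k' = ∫ d k₁ + ε ∫ d S d`, the flip Dirichlet form, and AM–GM
  have i1 : Integrable (fun x => d x * k₁ x) μ := hdL.integrable_mul hk₁L2
  have i2 : Integrable (fun x => d x * flipNoise L d x) μ := hdL.integrable_mul hSdL2
  have hsplit : ∫ x, d x * k' x ∂μ = (∫ x, d x * k₁ x ∂μ) + ε * ∫ x, d x * flipNoise L d x ∂μ := by
    have e : (fun x => d x * k' x) = fun x => d x * k₁ x + ε * (d x * flipNoise L d x) := by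
      funext x; rw [hk']; ring
    rw [e, integral_add i1 (i2.const_mul ε), integral_const_mul]
  have hdS : ∫ x, d x * flipNoise L d x ∂μ = -(1 / 2) * ∑ i, ∫ x, (d (momentumFlip i x) - d x) ^ 2 ∂μ :=
    integral_mul_flipNoise_self hflip hdL
  have i3 : Integrable (fun x => (4 : ℝ)⁻¹ * (s * w x ^ 2)) μ := (hwL.integrable_sq.const_mul s).const_mul _
  have hmono : ∫ x, d x * k₁ x ∂μ ≤ ∫ x, (4 : ℝ)⁻¹ * (s * w x ^ 2) ∂μ := by
    refine integral_mono i1 i3 fun x => ?_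
    have h : 0 ≤ s * (d x + w x / 2) ^ 2 := by positivity
    show d x * (-(s * d x + s * w x)) ≤ 4⁻¹ * (s * w x ^ 2)
    nlinarith [h]
  rw [integral_const_mul, integral_const_mul] at hmono
  have hw0 : 0 ≤ ∫ x, w x ^ 2 ∂μ := integral_nonneg fun x => sq_nonneg _
  have hsw : 0 ≤ s * ∫ x, w x ^ 2 ∂μ := mul_nonneg hs hw0
  have h2 : ∫ x, d x * k' x ∂μ =
      (∫ x, d x * k₁ x ∂μ) - (1 / 2) * (ε * ∑ i, ∫ x, (d (momentumFlip i x) - d x) ^ 2 ∂μ) := by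
    rw [hsplit, hdS]; ring
  rw [h2] at hpos
  linarith [hpos, hmono, hsw]

/-- **Odd-pairing bound for the total current.** There is `M ≥ 0` (the uniform `L²(μ_T)` bound of the half
currents) such that `|∫ J v dμ_T| ≤ L √(M Σ_i ‖v∘F_i − v‖²)` for every length `L` and every `v ∈ L²(μ_T)`:
each half current `p_k V'(q_{i+1} − q_i)` is odd under the flip `F_k`. [cite: BernardinOlla2011, §3] [folklore] -/
theorem abs_integral_sum_bondCurrent_mul_le (hω : 0 < ω₂) (hl : 0 < lam) (hβ : 0 < β) (γ : ℝ) {T : ℝ}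
    (hT : 0 < T) :
    ∃ M : ℝ, 0 ≤ M ∧ ∀ (L : ℕ) (v : PhaseSpace L → ℝ),
      MemLp v 2 ((pinnedChain ω₂ lam β γ).gibbsMeasure L T) →
      |∫ x, (∑ i : Fin L, (pinnedChain ω₂ lam β γ).bondCurrent L i x) * v x
          ∂((pinnedChain ω₂ lam β γ).gibbsMeasure L T)| ≤
        L * Real.sqrt (M * ∑ i : Fin L, ∫ x, (v (momentumFlip i x) - v x) ^ 2
          ∂((pinnedChain ω₂ lam β γ).gibbsMeasure L T)) := by
  obtain ⟨M, hM⟩ := gibbsHalfCurrentSqLe hω hl.le hβ.le γ hT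
  have hM0 : 0 ≤ M := (integral_nonneg fun x => sq_nonneg _).trans (hM 1 0 0 0).2
  refine ⟨M, hM0, fun L v hv => ?_⟩
  set P := pinnedChain ω₂ lam β γ with hP
  set μ := P.gibbsMeasure L T with hμ
  have hflip : ∀ k : Fin L, MeasurePreserving (momentumFlip k) μ μ := fun k =>
    P.measurePreserving_momentumFlip_gibbsMeasure L T k
  set E : ℝ := ∑ i : Fin L, ∫ x, (v (momentumFlip i x) - v x) ^ 2 ∂μ with hE
  have hEi0 : ∀ i : Fin L, 0 ≤ ∫ x, (v (momentumFlip i x) - v x) ^ 2 ∂μ := fun i =>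
    integral_nonneg fun x => sq_nonneg _
  have hEi : ∀ i : Fin L, ∫ x, (v (momentumFlip i x) - v x) ^ 2 ∂μ ≤ E := fun i =>
    Finset.single_le_sum (f := fun j => ∫ x, (v (momentumFlip j x) - v x) ^ 2 ∂μ) (fun j _ => hEi0 j)
      (Finset.mem_univ i)
  have hE0 : 0 ≤ E := Finset.sum_nonneg fun i _ => hEi0 i
  -- per bond: `|∫ j_i v| ≤ √(M E)`
  have hbond : ∀ i : Fin L, |∫ x, P.bondCurrent L i x * v x ∂μ| ≤ Real.sqrt (M * E) := by
    intro i
    by_cases hi : i.val + 1 < L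
    · obtain ⟨j, hij⟩ : ∃ j : Fin L, j.val = i.val + 1 := ⟨⟨i.val + 1, hi⟩, rfl⟩
      set a : PhaseSpace L → ℝ := fun x => x.2 i * deriv P.V (x.1 j - x.1 i) with ha
      set b : PhaseSpace L → ℝ := fun x => x.2 j * deriv P.V (x.1 j - x.1 i) with hb
      have hj_eq : ∀ x, P.bondCurrent L i x = -(1 / 2) * (a x + b x) := by
        intro x
        unfold OscillatorChain.bondCurrent
        rw [Finset.sum_eq_single j]
        · rw [if_pos hij]; simp only [ha, hb]; ring
        · intro j' _ hj'
          rw [if_neg]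
          intro hv'
          exact hj' (Fin.ext (by omega))
        · intro h; exact absurd (Finset.mem_univ j) h
      obtain ⟨haL, haM⟩ := hM L i i j
      obtain ⟨hbL, hbM⟩ := hM L j i j
      have hodd_a : ∀ x, a (momentumFlip i x) = -a x := by
        intro x
        simp only [ha, momentumFlip_fst, momentumFlip_snd_self]
        ring
      have hodd_b : ∀ x, b (momentumFlip j x) = -b x := by
        intro x
        simp only [hb, momentumFlip_fst, momentumFlip_snd_self]
        ring
      have hca := sq_integral_mul_le_of_odd (hflip i) hv haL hodd_a
      have hcb := sq_integral_mul_le_of_odd (hflip j) hv hbL hodd_b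
      have ha0 : 0 ≤ ∫ x, a x ^ 2 ∂μ := integral_nonneg fun x => sq_nonneg _
      have hb0 : 0 ≤ ∫ x, b x ^ 2 ∂μ := integral_nonneg fun x => sq_nonneg _
      have hIa : (∫ x, v x * a x ∂μ) ^ 2 ≤ M * E / 4 := by
        refine hca.trans ?_
        have h1 := mul_le_mul (hEi i) haM ha0 hE0
        linarith
      have hIb : (∫ x, v x * b x ∂μ) ^ 2 ≤ M * E / 4 := by
        refine hcb.trans ?_
        have h1 := mul_le_mul (hEi j) hbM hb0 hE0
        linarith
      have hA : |∫ x, v x * a x ∂μ| ≤ Real.sqrt (M * E / 4) := Real.abs_le_sqrt hIa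
      have hB : |∫ x, v x * b x ∂μ| ≤ Real.sqrt (M * E / 4) := Real.abs_le_sqrt hIb
      have h4 : Real.sqrt (M * E / 4) ≤ Real.sqrt (M * E) :=
        Real.sqrt_le_sqrt (by nlinarith [mul_nonneg hM0 hE0])
      have hsplit : ∫ x, P.bondCurrent L i x * v x ∂μ =
          -(1 / 2) * ((∫ x, v x * a x ∂μ) + ∫ x, v x * b x ∂μ) := by
        have e : (fun x => P.bondCurrent L i x * v x) = fun x => -(1 / 2) * (v x * a x + v x * b x) := by
          funext x; rw [hj_eq x]; ring
        have i1 : Integrable (fun x => v x * a x) μ := hv.integrable_mul haL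
        have i2 : Integrable (fun x => v x * b x) μ := hv.integrable_mul hbL
        rw [e, integral_const_mul, integral_add i1 i2]
      rw [hsplit, abs_mul, abs_neg, abs_of_pos (by norm_num : (0 : ℝ) < 1 / 2)]
      have := abs_add_le (∫ x, v x * a x ∂μ) (∫ x, v x * b x ∂μ)
      linarith
    · have h0 : ∀ x, P.bondCurrent L i x = 0 := by
        intro x
        unfold OscillatorChain.bondCurrent
        refine Finset.sum_eq_zero fun j _ => ?_
        rw [if_neg]
        intro h
        have := j.isLt
        omega
      simp only [h0, zero_mul, integral_zero, abs_zero]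
      exact Real.sqrt_nonneg _
  calc |∫ x, (∑ i : Fin L, P.bondCurrent L i x) * v x ∂μ|
        = |∑ i : Fin L, ∫ x, P.bondCurrent L i x * v x ∂μ| := by
          rw [integral_sum_bondCurrent_mul hω hl.le hβ.le γ L hT hv]
    _ ≤ ∑ i : Fin L, |∫ x, P.bondCurrent L i x * v x ∂μ| := Finset.abs_sum_le_sum_abs _ _
    _ ≤ ∑ _i : Fin L, Real.sqrt (M * E) := Finset.sum_le_sum fun i _ => hbond i
    _ = L * Real.sqrt (M * E) := by
          rw [Finset.sum_const, Finset.card_univ, Fintype.card_fin, nsmul_eq_mul]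

end Estimates

/-! ## Registered helper -/

/-- Registered helper sub-goal `helper_abelLimitEnergyEstimate` of stub `stub_abelLimit` (line
`abel-kapitza-even-corrector`, crux stmt-AtomisticToContinuum-11977): the energy estimate `flipDirichlet_le` —
if `L_ε d = s d + s w` pointwise with `s ≥ 0`, `d ∈ C² ∩ L²(μ_T)`, `w ∈ L²(μ_T)`, then
`ε Σ_i ‖d∘F_i − d‖²_{L²(μ_T)} ≤ s ‖w‖²_{L²(μ_T)}` (notation-free restatement). [cite: BernardinOlla2011, §3] [folklore] -/
theorem helper_abelLimitEnergyEstimate : ∀ (ω₂ lam β γ T ε : ℝ), 0 < ω₂ → 0 < lam → 0 < β → 0 < γ → 0 < T → ∀ (L : ℕ) (s : ℝ), 0 ≤ s → ∀ (d w : Literature.MathematicalPhysics.KineticTheory.HeatConduction.PhaseSpace L → ℝ), ContDiff ℝ 2 d → MeasureTheory.MemLp d 2 ((Literature.MathematicalPhysics.KineticTheory.HeatConduction.pinnedChain ω₂ lam β γ).gibbsMeasure L T) → MeasureTheory.MemLp w 2 ((Literature.MathematicalPhysics.KineticTheory.HeatConduction.pinnedChain ω₂ lam β γ).gibbsMeasure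 L T) → (∀ x, (Literature.MathematicalPhysics.KineticTheory.HeatConduction.pinnedChain ω₂ lam β γ).flipGenerator L T T ε d x = s * d x + s * w x) → ε * ∑ i : Fin L, MeasureTheory.integral ((Literature.MathematicalPhysics.KineticTheory.HeatConduction.pinnedChain ω₂ lam β γ).gibbsMeasure L T) (fun x => (d (Literature.MathematicalPhysics.KineticTheory.HeatConduction.momentumFlip i x) - d x) ^ 2) ≤ s * MeasureTheory.integral ((Literature.MathematicalPhysics.KineticTheory.HeatConduction.pinnedChain ω₂ lam β γ).gibbsMeasure L T) (fun x => w x ^ 2) :=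
  fun _ _ _ _ _ ε hω hl hβ hγ hT L _ hs _ _ hd2 hdL hwL hpde => flipDirichlet_le hω hl hβ hγ hT ε L hs hd2 hdL hwL hpde

end Summit.AtomisticToContinuum.FouriersLaw.Cruxes.NoisyFourier.AbelKapitzaEvenCorrector

end
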